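import Summits.Ventures.PercRepro.RankLevelSetHallBooleanDeficit

/-!
# PercRepro — THE DEMAND-HARMONIC RECEIPT CONDITION CLOSES C-044 UP AT THE TIGHT LAYER
(p4, gen 40; paper proofs/P4-DEMAND.md §3–§4; C-044 at the tight layer `#E = p + q`, any `k = p − q ≥ 2`)

The demand transfer (`hallUp_of_demand_le_big`) asks for a transport of the demands `δ(Z)` of the members into the big UP-neighbours,
capacities `1`.  THIS FILE states the candidate transport of record: a big set `B` of size `p` divides its unit capacity among the
members inside it IN PROPORTION TO THEIR DEMANDS — `Z` receives `δ(Z)/Δ(B)` from `B`, `Δ(B) = Σ_{Z' ⊆ B} δ(Z')` (`bigDemand`) — so every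
`B` is loaded exactly `≤ 1`, and `Z` receives `δ(Z) · Σ_{B ⊇ Z, #B = p, q < r(B) < p} 1/Δ(B)`.  The **DEMAND-HARMONIC RECEIPT CONDITION**
`DemandHarmonic M p q` (a `Prop`, NOT asserted): `Σ_{B ⊇ Z big, #B = p} 1/Δ(B) ≥ 1` for every member `Z` with `δ(Z) > 0`.  It gives
`Σ_{Z ∈ 𝒜} δ(Z) ≤ #Big(𝒜)` for every family (`demand_le_big_of_demandHarmonic`) and hence **C-044 UP at the tight layer**
(`hallUp_of_demandHarmonic`).  Census (p4 g40): the receipt `Σ 1/Δ(B)` is `≥ 2` for every member on every instance tested — random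
GF(2,3,5) `n ≤ 11`, the fat / generic-fat / killer / parallel-pair / parallel-copy families, the explicit circuit-with-shadowed-coloops
family to `q = 23` (`n = 48`, exact local computation) on which the uniform re-routing fails, and `B₄ ⊕ B₅` (`n = 20`, receipt `≥ 4.57`);
the minimum `2` is attained on `U_{q,2q} ⊕ Free(2)` (`k = 2`).  The earlier local candidates (uniform extension weights, `1/m(B)`) are refuted
by explicit instances (paper §3).  Nothing beyond the transfer is asserted.

* `bigPSupersets`, `bigPSupersets_finite`, `bigDemand`, `bigDemand_nonneg`, `lostDemand_nonneg`, `lostDemand_le_bigDemand`;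
* `DemandHarmonic` (DEF, the candidate lemma of record);
* **`demand_le_big_of_demandHarmonic`**, **`hallUp_of_demandHarmonic`**.
Axioms: standard.
-/

namespace PercRepro

open Set Matroid Finset

variable {α : Type} (M : Matroid α) [M.Finite]

/-- The big UP-neighbours of the cell of size exactly `p` containing `Z`. -/
def bigPSupersets (p q : ℕ) (Z : Set α) : Set (Set α) :=
  {B | B ∈ bigUpSets M p q (cellMembers M p q) ∧ Z ⊆ B ∧ B.ncard = p}

/-- `bigPSupersets` is finite. -/
theorem bigPSupersets_finite (p q : ℕ) (Z : Set α) : (bigPSupersets M p q Z).Finite :=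
  M.ground_finite.finite_subsets.subset (fun _ h => h.1.1.1)

/-- **The demand inside a set**: `Δ(B) = Σ_{Z ⊆ B member} δ(Z)`. -/
noncomputable def bigDemand (p q : ℕ) (B : Set α) : ℚ := by
  classical
  exact ∑ Z ∈ (cellMembers_finite M p q).toFinset.filter (fun Z => Z ⊆ B), lostDemand M p q Z

omit [M.Finite] in
/-- The demand of a member is non-negative. -/
theorem lostDemand_nonneg (p q : ℕ) (Z : Set α) : 0 ≤ lostDemand M p q Z := by
  unfold lostDemand
  apply Finset.sum_nonneg
  intro a _
  positivity

/-- The demand inside a set is non-negative. -/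
theorem bigDemand_nonneg (p q : ℕ) (B : Set α) : 0 ≤ bigDemand M p q B := by
  unfold bigDemand
  apply Finset.sum_nonneg
  intro Z _
  exact lostDemand_nonneg M p q Z

/-- A member inside `B` contributes at most `Δ(B)`: `δ(Z) ≤ Δ(B)`. -/
theorem lostDemand_le_bigDemand (p q : ℕ) {Z B : Set α} (hZ : Z ∈ cellMembers M p q) (hZB : Z ⊆ B) :
    lostDemand M p q Z ≤ bigDemand M p q B := by
  classical
  unfold bigDemand
  apply Finset.single_le_sum (f := fun Z => lostDemand M p q Z) (fun Z _ => lostDemand_nonneg M p q Z)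
  rw [Finset.mem_filter, Set.Finite.mem_toFinset]
  exact ⟨hZ, hZB⟩

/-- **THE DEMAND-HARMONIC RECEIPT CONDITION** (a `Prop`, NOT asserted): every member with positive demand sees harmonic weight at
least `1` on its big supersets of size `p`, `Σ_{B} 1/Δ(B) ≥ 1`. -/
def DemandHarmonic (p q : ℕ) : Prop :=
  ∀ Z ∈ cellMembers M p q, 0 < lostDemand M p q Z →
    1 ≤ ∑ B ∈ (bigPSupersets_finite M p q Z).toFinset, 1 / bigDemand M p q B

/-- **The demand inequality from the demand-harmonic condition**: `Σ_{Z ∈ 𝒜} δ(Z) ≤ #Big(𝒜)` for every family of members — the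
proportional transport `δ(Z)/Δ(B)` loads every big set at most `1` and delivers `δ(Z)` to every member. -/
theorem demand_le_big_of_demandHarmonic (p q : ℕ) (h : DemandHarmonic M p q) {𝒜 : Set (Set α)}
    (h𝒜 : 𝒜 ⊆ cellMembers M p q) :
    ∑ Z ∈ ((cellMembers_finite M p q).subset h𝒜).toFinset, lostDemand M p q Z ≤ ((bigUpSets M p q 𝒜).ncard : ℚ) := by
  classical
  have h𝒜fin : 𝒜.Finite := (cellMembers_finite M p q).subset h𝒜
  set 𝒜f : Finset (Set α) := h𝒜fin.toFinset with h𝒜f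
  have hmem𝒜 : ∀ Z, Z ∈ 𝒜f ↔ Z ∈ 𝒜 := fun Z => by rw [h𝒜f, Set.Finite.mem_toFinset]
  have hbfin : (bigUpSets M p q 𝒜).Finite :=
    ((cellY_finite M p q).subset (upNbhd_subset_cellY 𝒜 p q)).subset (fun _ h => h.1)
  set Bf : Finset (Set α) := hbfin.toFinset with hBf
  have hmemBf : ∀ B, B ∈ Bf ↔ B ∈ bigUpSets M p q 𝒜 := fun B => by rw [hBf, Set.Finite.mem_toFinset]
  -- the transport weight
  let w : Set α → Set α → ℚ := fun Z B =>
    if Z ⊆ B ∧ B.ncard = p ∧ 0 < lostDemand M p q Z then lostDemand M p q Z / bigDemand M p q B else 0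
  have hwnn : ∀ Z B, 0 ≤ w Z B := by
    intro Z B
    simp only [w]
    split_ifs
    · exact div_nonneg (lostDemand_nonneg M p q Z) (bigDemand_nonneg M p q B)
    · exact le_rfl
  -- receipts: every member of 𝒜 receives at least δ(Z) over Bf
  have hrecv : ∀ Z ∈ 𝒜f, lostDemand M p q Z ≤ ∑ B ∈ Bf, w Z B := by
    intro Z hZ
    have hZ𝒜 : Z ∈ 𝒜 := (hmem𝒜 Z).1 hZ
    have hZm : Z ∈ cellMembers M p q := h𝒜 hZ𝒜
    by_cases hpos : 0 < lostDemand M p q Z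
    · have hsub : (bigPSupersets_finite M p q Z).toFinset ⊆ Bf := by
        intro B hB
        rw [Set.Finite.mem_toFinset] at hB
        rw [hmemBf]
        obtain ⟨⟨⟨hBE, hq, hp', -⟩, hcard⟩, hZB, -⟩ := hB
        exact ⟨⟨hBE, hq, hp', Z, hZ𝒜, hZB⟩, hcard⟩
      have h1 : lostDemand M p q Z * 1 ≤ lostDemand M p q Z * ∑ B ∈ (bigPSupersets_finite M p q Z).toFinset, 1 / bigDemand M p q B :=
        mul_le_mul_of_nonneg_left (h Z hZm hpos) (lostDemand_nonneg M p q Z)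
      have h2 : lostDemand M p q Z * ∑ B ∈ (bigPSupersets_finite M p q Z).toFinset, 1 / bigDemand M p q B
          = ∑ B ∈ (bigPSupersets_finite M p q Z).toFinset, w Z B := by
        rw [Finset.mul_sum]
        apply Finset.sum_congr rfl
        intro B hB
        rw [Set.Finite.mem_toFinset] at hB
        obtain ⟨-, hZB, hcard⟩ := hB
        simp only [w, if_pos (And.intro hZB (And.intro hcard hpos))]
        rw [mul_one_div]
      calc lostDemand M p q Z = lostDemand M p q Z * 1 := (mul_one _).symm
        _ ≤ lostDemand M p q Z * ∑ B ∈ (bigPSupersets_finite M p q Z).toFinset, 1 / bigDemand M p q B := h1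
        _ = ∑ B ∈ (bigPSupersets_finite M p q Z).toFinset, w Z B := h2
        _ ≤ ∑ B ∈ Bf, w Z B := Finset.sum_le_sum_of_subset_of_nonneg hsub (fun B _ _ => hwnn Z B)
    · have h0 : lostDemand M p q Z = 0 := le_antisymm (not_lt.1 hpos) (lostDemand_nonneg M p q Z)
      rw [h0]
      exact Finset.sum_nonneg (fun B _ => hwnn Z B)
  -- loads: every big set is loaded at most 1
  have hload : ∀ B ∈ Bf, ∑ Z ∈ 𝒜f, w Z B ≤ 1 := by
    intro B hB
    by_cases hD : bigDemand M p q B = 0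
    · apply le_of_eq_of_le _ zero_le_one
      apply Finset.sum_eq_zero
      intro Z _
      simp only [w]
      split_ifs
      · rw [hD, div_zero]
      · rfl
    · have hDpos : 0 < bigDemand M p q B := lt_of_le_of_ne (bigDemand_nonneg M p q B) (Ne.symm hD)
      have hsum : ∑ Z ∈ 𝒜f, w Z B ≤ ∑ Z ∈ 𝒜f.filter (fun Z => Z ⊆ B), lostDemand M p q Z / bigDemand M p q B := by
        rw [Finset.sum_filter]
        apply Finset.sum_le_sum
        intro Z _
        simp only [w]
        split_ifs with h1 h2
        · exact le_rfl
        · exact absurd h1.1 h2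
        · exact div_nonneg (lostDemand_nonneg M p q Z) (bigDemand_nonneg M p q B)
        · exact le_rfl
      have hsub : 𝒜f.filter (fun Z => Z ⊆ B) ⊆ (cellMembers_finite M p q).toFinset.filter (fun Z => Z ⊆ B) := by
        intro Z hZ
        rw [Finset.mem_filter] at hZ ⊢
        rw [Set.Finite.mem_toFinset]
        exact ⟨h𝒜 ((hmem𝒜 Z).1 hZ.1), hZ.2⟩
      calc ∑ Z ∈ 𝒜f, w Z B ≤ ∑ Z ∈ 𝒜f.filter (fun Z => Z ⊆ B), lostDemand M p q Z / bigDemand M p q B := hsum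
        _ = (∑ Z ∈ 𝒜f.filter (fun Z => Z ⊆ B), lostDemand M p q Z) / bigDemand M p q B := by rw [Finset.sum_div]
        _ ≤ (∑ Z ∈ (cellMembers_finite M p q).toFinset.filter (fun Z => Z ⊆ B), lostDemand M p q Z) / bigDemand M p q B := by
            apply div_le_div_of_nonneg_right _ hDpos.le
            exact Finset.sum_le_sum_of_subset_of_nonneg hsub (fun Z _ _ => lostDemand_nonneg M p q Z)
        _ = bigDemand M p q B / bigDemand M p q B := by
            unfold bigDemand
            rfl
        _ = 1 := div_self hD
  -- the double count
  calc ∑ Z ∈ 𝒜f, lostDemand M p q Z ≤ ∑ Z ∈ 𝒜f, ∑ B ∈ Bf, w Z B := Finset.sum_le_sum hrecv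
    _ = ∑ B ∈ Bf, ∑ Z ∈ 𝒜f, w Z B := Finset.sum_comm
    _ ≤ ∑ B ∈ Bf, (1 : ℚ) := Finset.sum_le_sum hload
    _ = ((bigUpSets M p q 𝒜).ncard : ℚ) := by
        rw [Finset.sum_const, nsmul_eq_mul, mul_one, hBf, ← ncard_eq_toFinset_card _ hbfin]

/-- **C-044 UP AT THE TIGHT LAYER FROM THE DEMAND-HARMONIC CONDITION**: the UP-Hall condition for every family of members. -/
theorem hallUp_of_demandHarmonic (p q : ℕ) (hp : q + 2 ≤ p) (hE : M.E.ncard = p + q) (h : DemandHarmonic M p q)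
    (𝒜 : Set (Set α)) (h𝒜 : 𝒜 ⊆ cellMembers M p q) :
    phiK p q * (𝒜.ncard : ℚ) ≤ ((upNbhd M p q 𝒜).ncard : ℚ) :=
  hallUp_of_demand_le_big M p q hp hE h𝒜 (demand_le_big_of_demandHarmonic M p q h h𝒜)

end PercRepro
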